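import Literature.NumberTheory.Automorphic.HilbertModularGaloisRepProofs
import Literature.NumberTheory.Automorphic.BockleHuiIrreducibleGL3AnalyticProofs
import Literature.NumberTheory.Automorphic.RamakrishnanMultiplicityOneSL2Reductions
import Literature.NumberTheory.Automorphic.RamakrishnanMultiplicityOneLemma414
import Literature.NumberTheory.Automorphic.PairLFunctionPolesRepData
import Literature.NumberTheory.Automorphic.PairLFunctionPolesRankNeLandau
import Literature.NumberTheory.Automorphic.PairLFunctionPolesRankNeTwist
import Literature.NumberTheory.Automorphic.PairLFunctionPolesGLOneProofs
import Literature.NumberTheory.Automorphic.AutomorphicTwistHecke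
import Literature.NumberTheory.Automorphic.CuspidalDescentDetCubicRepData
import Literature.NumberTheory.Automorphic.GLOneOfHeckeCharacterBJ
import Literature.NumberTheory.Automorphic.IdeleNormDetGL
import Literature.NumberTheory.Automorphic.AsaiSign
import Literature.NumberTheory.GaloisRepresentations.HeckeLFunctionNonvanishingProofs
import Literature.NumberTheory.GaloisRepresentations.HeckeLFunctionNonvanishingLineProofs
import Literature.NumberTheory.GaloisRepresentations.HeckeLFunctionAnalyticProofs
import HarnessLib

/-!
# Galois representations of Hilbert modular eigenforms: the analytic half of Ribet's
# irreducibility argument ("contradicting the cuspidality of `π`"), from Jacquet–Shalika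

Topic `Literature/NumberTheory/Automorphic`; namespace `Literature.NumberTheory.Automorphic`.
Second PROOFS file (theorems only: no definition, no named fact, no instance, no `sorry`) for the
named fact `galoisRep_GL2_totallyReal_irreducible` of `HilbertModularGaloisRep` (Ribet; Skinner,
Doc. Math. 14 (2009), §2.4.2 and the Remark on p. 257), after `HilbertModularGaloisRepProofs`.

That file assembled the fact from the two inputs of its printed proof
(`galoisRep_GL2_totallyReal_irreducible_of_weaklyDivides_of_heckeEigenvalue_mem_of_not_eisenstein`):
the dictionary "abelian summands of `ρ_π` are Hecke" (Böckle–Hui Thm. 1.1, the tree's named fact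
`GaloisRepresentations.exists_heckeCharacter_of_weaklyDivides`, plus the rationality of the Hecke
eigenvalues of `π`) and the **analytic half** `hJS`, left there as an explicit hypothesis:

> (Skinner 2009, Remark p. 257) "It then follows that `L(π ⊗ ψ₂⁻¹, s − 1/2) = L(ψ₁/ψ₂, s) ζ_F(s)`.
> As `ψ_i = ψ'_i |·|^{a_i}`, `a₁ ≥ a₂`, `L(ψ₁/ψ₂, 1) ≠ 0`.  But this implies that `L(π ⊗ ψ₂⁻¹, s)`
> has a pole at `s = 1`, contradicting the cuspidality of `π`."

i.e. *a cuspidal automorphic representation of `GL₂(𝔸_F)` is not nearly equivalent to the isobaric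
sum `ψ₁|·|^{1/2} ⊞ ψ₂|·|^{1/2}` of two idele class characters* (Jacquet–Shalika 1981 II, Thm. 4.4).
This file PROVES `hJS` from named facts of the tree — Jacquet–Shalika (2.1)–(2.3) for Borel–Jacquet
data, `JacquetShalika1981_multipliable_partialPairL_repData`, `…_partialPairL_boundary_repData`,
`…_partialPairL_pole_repData` of `PairLFunctionPolesRepData` (Arthur–Clozel 1989, Ch. 3 §2) — in
the same way as `RamakrishnanMultiplicityOneLemma414` and `BockleHuiIrreducibleGL3AnalyticProofs`
run their pole counts, and for ARBITRARY number fields `F`, cuspidal data `π` and Hecke characters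
`χ₁, χ₂` (no total reality, regularity or algebraicity is used).

## The rendering and the proof

The hypothesis to refute is the conclusion shape of `HilbertModularGaloisRepProofs`: at almost
every finite place `v`, every Satake parameter `α` of `π` has `{√q_v a : a ∈ α} = {χ₁(ϖ_v), χ₂(ϖ_v)}`.

1. *Unitary normalisation* (Borel–Jacquet 1979, 5.7; (2.1)–(2.3) are vendored for unitary Satake
   families, `|det t_w| = 1`).  `|χ_i| = ‖·‖^{σ_i}` on ideles
   (`HeckeCharacter.exists_norm_apply_eq_ideleNorm_rpow`); after swapping, `σ₁ ≤ σ₂`.  The twist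
   `π₁ = π ⊗ ‖·‖^{z}`, `z = -1/2 - (σ₁+σ₂)/2` (`CuspidalAutomorphicRepData.exists_twist_hecke_hasSatakeParamAt`,
   `exists_heckeCharacter_ideleNorm_cpow`) has Satake parameters `{μ₁(ϖ_w), μ₂(ϖ_w)}` a.e. with
   `μ_i = χ_i ‖·‖^{1/2+z}`, `|μ₁| = ‖·‖^{-t}`, `|μ₂| = ‖·‖^{t}`, `t = (σ₂ - σ₁)/2 ≥ 0`
   (`not_eventually_satake_eq_heckePair_of_JS`).
2. *`t > 0`: the pole leaves the line* (`false_of_hasSatakeParamAt_heckePair_of_pos`).  With the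
   unitary `ν = (μ₁‖·‖^t)⁻¹` realised on `GL(1)` (`exists_cuspidal_glOne_hasSatakeParamAt_valueAtUniformizer`),
   the Euler factor of `L^S(s, π₁ × ν)` at `s = 1 + t` is `(1 - q_v⁻¹)⁻¹ (1 - d_v)⁻¹` with
   `‖d_v‖ = q_v^{-1-2t}` (`eval_satakePairPolynomial_pair_singleton`); (2.1) asserts that this Euler
   product is multipliable at `Re s = 1 + t > 1`, which is absurd: `∑_v q_v⁻¹ = ∞`
   (`not_multipliable_of_mul_one_sub_eq_zetaFactor`, from `not_summable_residueCard_inv`).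
3. *`t = 0`: a simple pole against a finite limit* (`false_of_hasSatakeParamAt_heckePair_of_isUnitary`).
   Now `μ₁, μ₂` are unitary.  (2.2) at `s₀ = 1` for the pairs `(π₁, μ₁⁻¹)`, `(π₁, μ₂⁻¹)` (`2 ≠ 1`, so
   `X = ∅`) gives finite limits of `L^S(s, π₁ × μ₁⁻¹) = ζ_F^S(s) L^S(s, μ₂/μ₁)` and
   `L^S(s, π₁ × μ₂⁻¹)`; the twist `π₁' = π₁ ⊗ (μ₁μ₂)⁻¹` has the contragredient parameters
   `{μ₂(ϖ)⁻¹, μ₁(ϖ)⁻¹}`, so (2.3) at `s₀ = 1 ∈ X` gives `(s - 1) L^S(s, π₁ × π₁') → c ≠ 0`; but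
   factor by factor `L^S(s, π₁ × π₁') = L^S(s, π₁ × μ₂⁻¹) · L^S(s, π₁ × μ₁⁻¹)` on `Re s > 1`, whence
   `(s - 1) L^S(s, π₁ × π₁') → 0`.  (This replaces Skinner's appeal to `L(ψ₁/ψ₂, 1) ≠ 0`, i.e. to
   Hecke's continuation, by Jacquet–Shalika's own (2.3).)

## Main statements (all proved)

* `not_eventually_satake_eq_heckePair_of_JS` — the analytic half for one `π`, `χ₁`, `χ₂` over any
  number field, from `hJ1`–`hJ3`.
* `not_nearlyEisenstein_GL2_totallyReal_of_JS` — the hypothesis `hJS` of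
  `galoisRep_GL2_totallyReal_irreducible_of_abelianSummandIsHecke_of_not_eisenstein`, verbatim.
* `galoisRep_GL2_totallyReal_irreducible_of_abelianSummandIsHecke_of_JS`,
  `galoisRep_GL2_totallyReal_irreducible_of_weaklyDivides_of_rational_of_JS`,
  `galoisRep_GL2_totallyReal_irreducible_of_weaklyDivides_of_heckeEigenvalue_mem_of_JS` — **what now
  separates `galoisRep_GL2_totallyReal_irreducible_holds` from the tree**: the named facts
  `GaloisRepresentations.exists_heckeCharacter_of_weaklyDivides` (Böckle–Hui Thm. 1.1) and
  `JacquetShalika1981_{multipliable_partialPairL,partialPairL_boundary,partialPairL_pole}_repData`,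
  and one printed input without carrier in the tree, the rationality of the unramified Hecke
  eigenvalues of a regular algebraic cuspidal `π` on `GL₂` over a totally real field (Shimura 1978;
  Clozel 1990, Thm. 3.13; Böckle–Hui §3.1).

## References

* C. Skinner, *A note on the `p`-adic Galois representations attached to Hilbert modular forms*,
  Doc. Math. 14 (2009) 241–258, §2.4.2 and the Remark on p. 257. [Skinner2009]
* H. Jacquet, J. A. Shalika, *On Euler products and the classification of automorphic forms II*,
  Amer. J. Math. 103 (1981), 777–815, Prop. 3.6, Thm. 4.4. [JacquetShalikaAJM1981II]
* J. Arthur, L. Clozel, *Simple algebras, base change, and the advanced theory of the trace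
  formula*, Ann. of Math. Stud. 120 (1989), Ch. 3 §2, (2.1)–(2.3), p. 171. [ArthurClozelAMS120]
* A. Borel, H. Jacquet, *Automorphic forms and automorphic representations*, Proc. Sympos. Pure
  Math. 33 (1979), part 1, §4.6, 5.7. [BorelJacquetCorvallis1979]
* D. Ramakrishnan, Ann. of Math. 152 (2000), Lemma 4.1.4 (the template of the pole count).
  [Ramakrishnan2000]
* G. Böckle, C.-Y. Hui, *Weak abelian direct summands and irreducibility of Galois
  representations*, Math. Ann. 393 (2025), Thm. 1.1 and §3.1. [BockleHui2025]
-/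

noncomputable section

open scoped MatrixGroups NumberField Classical Topology
open NumberField IsDedekindDomain MeasureTheory Filter Polynomial

namespace Literature.NumberTheory.Automorphic

open AdelicGroupData
open Literature.NumberTheory.GaloisRepresentations (HeckeCharacter ideleGroup localUnits ideleNorm)

/-! ### The partial Euler product of `ζ_F` at `s = 1` diverges -/

section Analytic

/-- `1 + ∑ aᵢ ≤ ∏ (1 + aᵢ)` for non-negative reals. [folklore] -/
private theorem hm_one_add_sum_le_prod_one_add {ι : Type*} (T : Finset ι) {a : ι → ℝ}
    (ha : ∀ i, 0 ≤ a i) : 1 + ∑ i ∈ T, a i ≤ ∏ i ∈ T, (1 + a i) := by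
  classical
  induction T using Finset.induction_on with
  | empty => simp
  | insert i T hi ih =>
    rw [Finset.sum_insert hi, Finset.prod_insert hi]
    have hs : 0 ≤ ∑ j ∈ T, a j := Finset.sum_nonneg fun j _ => ha j
    have hP : 1 ≤ ∏ j ∈ T, (1 + a j) := le_trans (by linarith) ih
    nlinarith [ha i, ih]

/-- Partial products of reals `≥ 1` are monotone in the finset. [folklore] -/
private theorem hm_prod_le_prod_of_subset_of_one_le {ι : Type*} {s t : Finset ι} (h : s ⊆ t)
    {f : ι → ℝ} (hf : ∀ i, 1 ≤ f i) : ∏ i ∈ s, f i ≤ ∏ i ∈ t, f i := by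
  classical
  rw [← Finset.prod_sdiff h]
  have h1 : 1 ≤ ∏ i ∈ t \ s, f i := by
    refine Finset.induction_on (t \ s) (by simp) fun j u hj ih => ?_
    rw [Finset.prod_insert hj]
    nlinarith [hf j, ih]
  have h0 : 0 ≤ ∏ i ∈ s, f i := Finset.prod_nonneg fun i _ => le_trans zero_le_one (hf i)
  nlinarith

variable {K : Type} [Field K] [NumberField K]

/-- **The partial Euler product of `ζ_K` at `s = 1` is not multipliable, even after an absolutely
convergent perturbation.** For a finite set `S` of finite places of `K`, a summable family
`∑_{v ∉ S} ‖d_v‖ < ∞` with `d_v ≠ 1`, no multipliable family `F` over `{v ∉ S}` satisfies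
`F_v (1 - d_v) = (1 - q_v⁻¹)⁻¹`: otherwise `v ↦ (1 - q_v⁻¹)⁻¹ = F_v (1 - d_v)` would be multipliable,
its real partial products `∏ (1 - q_v⁻¹)⁻¹ ≥ 1 + ∑ q_v⁻¹` bounded, and `∑_v q_v⁻¹ < ∞`, contradicting
the divergence of `∑_v q_v⁻¹` (`not_summable_residueCard_inv`, the pole of `ζ_K` at `1`).
[folklore] -/
theorem not_multipliable_of_mul_one_sub_eq_zetaFactor {S : Set (HeightOneSpectrum (𝓞 K))}
    (hS : S.Finite) {F d : {v : HeightOneSpectrum (𝓞 K) // v ∉ S} → ℂ}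
    (hd : Summable fun v => ‖d v‖)
    (hF : ∀ v, F v * (1 - d v) = (1 - ((v.1.residueCard : ℂ))⁻¹)⁻¹) :
    ¬ Multipliable F := by
  intro hm
  -- `Z_v = (1 - q_v⁻¹)⁻¹ = F_v (1 - d_v)` is multipliable
  have hG : Multipliable fun v : {v : HeightOneSpectrum (𝓞 K) // v ∉ S} => 1 - d v := by
    have h := multipliable_one_add_of_summable (f := fun v => -d v) (by simpa using hd)
    simpa [sub_eq_add_neg] using h
  have hZ : Multipliable fun v : {v : HeightOneSpectrum (𝓞 K) // v ∉ S} =>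
      (1 - ((v.1.residueCard : ℂ))⁻¹)⁻¹ := by
    have h := hm.mul hG
    simpa only [hF] using h
  obtain ⟨a, ha⟩ := hZ
  -- real partial products
  set r : {v : HeightOneSpectrum (𝓞 K) // v ∉ S} → ℝ := fun v => (1 - ((v.1.residueCard : ℝ))⁻¹)⁻¹
    with hr_def
  have hq : ∀ v : {v : HeightOneSpectrum (𝓞 K) // v ∉ S}, (2 : ℝ) ≤ v.1.residueCard := fun v => by
    exact_mod_cast v.1.one_lt_residueCard
  have hr1 : ∀ v, 1 + ((v.1.residueCard : ℝ))⁻¹ ≤ r v := fun v => by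
    have h2 := hq v
    have hq0 : (0 : ℝ) < v.1.residueCard := by linarith
    rw [hr_def]
    simp only
    rw [← one_div, ← one_div, le_div_iff₀ (by
      have : (1 : ℝ) / v.1.residueCard < 1 := by rw [div_lt_one hq0]; linarith
      linarith)]
    have hx : (0 : ℝ) ≤ 1 / v.1.residueCard := by positivity
    have hx1 : (1 : ℝ) / v.1.residueCard ≤ 1 := by rw [div_le_one hq0]; linarith
    nlinarith
  have hr_one : ∀ v, 1 ≤ r v := fun v => le_trans (by
    have : (0:ℝ) ≤ ((v.1.residueCard : ℝ))⁻¹ := by positivity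
    linarith) (hr1 v)
  have hnorm : ∀ v : {v : HeightOneSpectrum (𝓞 K) // v ∉ S},
      ‖(1 - ((v.1.residueCard : ℂ))⁻¹)⁻¹‖ = r v := fun v => by
    have h2 := hq v
    have h : (1 - ((v.1.residueCard : ℂ))⁻¹) = (((1 - ((v.1.residueCard : ℝ))⁻¹ : ℝ)) : ℂ) := by
      push_cast; ring
    rw [h, ← Complex.ofReal_inv, Complex.norm_real, Real.norm_eq_abs, abs_of_nonneg]
    exact le_trans zero_le_one (hr_one v)
  have hR : Tendsto (fun T : Finset {v : HeightOneSpectrum (𝓞 K) // v ∉ S} => ∏ v ∈ T, r v)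
      atTop (𝓝 ‖a‖) := by
    have h := ha.norm
    have hfun : (fun x : {v : HeightOneSpectrum (𝓞 K) // v ∉ S} =>
        ‖(1 - ((x.1.residueCard : ℂ))⁻¹)⁻¹‖) = r := funext hnorm
    rw [hfun] at h
    exact h
  -- the partial products are bounded by `‖a‖ + 1`
  obtain ⟨T₀, hT₀⟩ := Filter.eventually_atTop.mp (hR.eventually (eventually_lt_nhds (lt_add_one ‖a‖)))
  have hbound : ∀ T : Finset {v : HeightOneSpectrum (𝓞 K) // v ∉ S},
      ∑ v ∈ T, ((v.1.residueCard : ℝ))⁻¹ ≤ ‖a‖ := by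
    intro T
    have h1 : 1 + ∑ v ∈ T, ((v.1.residueCard : ℝ))⁻¹ ≤ ∏ v ∈ T, r v :=
      (hm_one_add_sum_le_prod_one_add T fun v => by positivity).trans
        (Finset.prod_le_prod (fun v _ => by positivity) fun v _ => hr1 v)
    have h2 : ∏ v ∈ T, r v ≤ ∏ v ∈ T ∪ T₀, r v :=
      hm_prod_le_prod_of_subset_of_one_le Finset.subset_union_left hr_one
    have h3 : ∏ v ∈ T ∪ T₀, r v < ‖a‖ + 1 := hT₀ _ Finset.subset_union_right
    linarith
  have hsum : Summable fun v : {v : HeightOneSpectrum (𝓞 K) // v ∉ S} => ((v.1.residueCard : ℝ))⁻¹ :=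
    summable_of_sum_le (fun v => by positivity) hbound
  have h4 : Summable fun v : HeightOneSpectrum (𝓞 K) => ((v.residueCard : ℝ))⁻¹ :=
    (hS.summable_compl_iff (f := fun v : HeightOneSpectrum (𝓞 K) => ((v.residueCard : ℝ))⁻¹)).mp hsum
  exact Literature.NumberTheory.GaloisRepresentations.not_summable_residueCard_inv h4

end Analytic


/-! ### Local algebra -/

section Algebra

/-- `det(1 - {a, b} ⊗ {c} x) = (1 - a c x)(1 - b c x)`. [folklore] -/
theorem eval_satakePairPolynomial_pair_singleton (a b c x : ℂ) :
    (satakePairPolynomial {a, b} {c}).eval x = (1 - a * c * x) * (1 - b * c * x) := by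
  rw [satakePairPolynomial_eq_eulerPolynomial, satakeTensor_singleton_right, eval_eulerPolynomial]
  simp [mul_comm c]

/-- `det(1 - α ⊗ (β + β') T) = det(1 - α ⊗ β T) · det(1 - α ⊗ β' T)` (a private copy of
`satakePairPolynomial_add_right` of `ArthurClozelGalOrbitLift`, not imported here). [folklore] -/
private theorem hm_satakePairPolynomial_add_right (α β β' : Multiset ℂ) :
    satakePairPolynomial α (β + β') = satakePairPolynomial α β * satakePairPolynomial α β' := by
  rw [satakePairPolynomial_eq_eulerPolynomial, satakePairPolynomial_eq_eulerPolynomial,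
    satakePairPolynomial_eq_eulerPolynomial, satakeTensor_add_right, eulerPolynomial_add]

end Algebra

/-! ### The core: no cuspidal `GL₂` datum has the Satake parameters `{μ₁(ϖ_v), μ₂(ϖ_v)}` -/

section Core

variable {F : Type} [Field F] [NumberField F]

/-- **Case `t > 0`: the pole of `L^S(s, π₁ × ν)` would lie inside `Re s > 1`.**  Granting
Jacquet–Shalika (2.1) for Borel–Jacquet data: no cuspidal datum `π` on `GL₂(𝔸_F)` has the Satake
parameters `{μ₁(ϖ_w), μ₂(ϖ_w)}` a.e. with `|μ₁| = ‖·‖^{-t}`, `|μ₂| = ‖·‖^{t}`, `t > 0` — for the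
unitary `ν = (μ₁ ‖·‖^t)⁻¹` on `GL(1)` the Euler factor of `L^S(s, π × ν)` at `s = 1 + t` is
`(1 - q_v⁻¹)⁻¹ (1 - d_v)⁻¹`, `‖d_v‖ = q_v^{-1-2t}`, and such a product is not multipliable
(`not_multipliable_of_mul_one_sub_eq_zetaFactor`), against (2.1) at `Re s = 1 + t > 1`.
[cite: ArthurClozelAMS120, Ch. 3 §2 (2.1)] [cite: JacquetShalikaAJM1981II, Thm. 4.4] -/
theorem false_of_hasSatakeParamAt_heckePair_of_pos
    (hJ1 : JacquetShalika1981_multipliable_partialPairL_repData)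
    {h2 : isCompact_glFiniteIntegralLevel 2 F}
    (π : CuspidalAutomorphicRepData 2 F h2) (μ₁ μ₂ : HeckeCharacter F) {t : ℝ} (ht : 0 < t)
    (hμ₁ : ∀ x : ideleGroup F, ‖((μ₁ x : ℂˣ) : ℂ)‖ = ideleNorm x ^ (-t))
    (hμ₂ : ∀ x : ideleGroup F, ‖((μ₂ x : ℂˣ) : ℂ)‖ = ideleNorm x ^ t)
    (hπ : ∀ᶠ w : HeightOneSpectrum (𝓞 F) in cofinite,
      π.1.HasSatakeParamAt w {μ₁.valueAtUniformizer w, μ₂.valueAtUniformizer w}) :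
    False := by
  have h1 := isCompact_glFiniteIntegralLevel_holds 1 F
  -- the unitary character `ν = (μ₁ ‖·‖^t)⁻¹` and its `GL₁` datum
  obtain ⟨Nt, hNt⟩ := exists_heckeCharacter_ideleNorm_cpow F (t : ℂ)
  set ν : HeckeCharacter F := (μ₁ * Nt)⁻¹ with hν_def
  have hNpos : ∀ x : ideleGroup F, 0 < ideleNorm x :=
    GaloisRepresentations.HeckeCharacter.ideleNorm_pos' F
  have hνu : ∀ x : ideleGroup F, ‖((ν x : ℂˣ) : ℂ)‖ = 1 := fun x => by
    rw [hν_def, GaloisRepresentations.HeckeCharacter.inv_apply,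
      GaloisRepresentations.HeckeCharacter.mul_apply, Units.val_inv_eq_inv_val, Units.val_mul,
      norm_inv, norm_mul, hμ₁ x,
      GaloisRepresentations.HeckeCharacter.norm_apply_of_forall_apply_eq_cpow hNt x,
      Complex.ofReal_re, ← Real.rpow_add (hNpos x), neg_add_cancel, Real.rpow_zero, inv_one]
  obtain ⟨τ, hτ⟩ := exists_cuspidal_glOne_hasSatakeParamAt_valueAtUniformizer h1 ν
  -- the exceptional set
  obtain ⟨S₀, hS₀, hJ⟩ := hJ1 2 1 F h2 h1 two_pos one_pos π τ
  set B : Set (HeightOneSpectrum (𝓞 F)) := {w | ¬ (π.1.HasSatakeParamAt w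
      {μ₁.valueAtUniformizer w, μ₂.valueAtUniformizer w} ∧
      τ.1.HasSatakeParamAt w {ν.valueAtUniformizer w})} with hB_def
  have hB : B.Finite := Filter.eventually_cofinite.mp (hπ.and hτ)
  set S : Set (HeightOneSpectrum (𝓞 F)) := S₀ ∪ B with hS_def
  have hS : S.Finite := hS₀.union hB
  have hBS : ∀ w ∉ S, π.1.HasSatakeParamAt w {μ₁.valueAtUniformizer w, μ₂.valueAtUniformizer w} ∧
      τ.1.HasSatakeParamAt w {ν.valueAtUniformizer w} := fun w hw => by
    by_contra h
    exact hw (Or.inr h)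
  set α : SatakeFamily F := fun w => {μ₁.valueAtUniformizer w, μ₂.valueAtUniformizer w} with hα_def
  set β : SatakeFamily F := fun w => {ν.valueAtUniformizer w} with hβ_def
  have hq0 : ∀ w : HeightOneSpectrum (𝓞 F), (0 : ℝ) < w.residueCard := fun w =>
    Nat.cast_pos.2 (Nat.zero_lt_of_lt w.one_lt_residueCard)
  have hn₁ : ∀ w, ‖μ₁.valueAtUniformizer w‖ = (w.residueCard : ℝ) ^ t := fun w => by
    rw [norm_valueAtUniformizer_eq_rpow_neg hμ₁ w, neg_neg]
  have hn₂ : ∀ w, ‖μ₂.valueAtUniformizer w‖ = (w.residueCard : ℝ) ^ (-t) := fun w =>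
    norm_valueAtUniformizer_eq_rpow_neg hμ₂ w
  have hnν : ∀ w, ‖ν.valueAtUniformizer w‖ = 1 := fun w =>
    GaloisRepresentations.HeckeCharacter.norm_valueAtUniformizer_of_isUnitary hνu w
  have hu : ∀ w ∉ S, ‖(α w).prod‖ = 1 := fun w _ => by
    simp only [hα_def, Multiset.insert_eq_cons, Multiset.prod_cons, Multiset.prod_singleton,
      norm_mul, hn₁, hn₂]
    rw [← Real.rpow_add (hq0 w), add_neg_cancel, Real.rpow_zero]
  have hu' : ∀ w ∉ S, ‖(β w).prod‖ = 1 := fun w _ => by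
    simp only [hβ_def, Multiset.prod_singleton, hnν]
  -- (2.1) at `s = 1 + t`
  set s : ℂ := ((1 + t : ℝ) : ℂ) with hs_def
  have hs : 1 < s.re := by rw [hs_def, Complex.ofReal_re]; linarith
  have hm := hJ hS Set.subset_union_left (fun w hw => (hBS w hw).1) (fun w hw => (hBS w hw).2)
    hu hu' hs
  -- the Euler factor at `v ∉ S` is `(1 - q_v⁻¹)⁻¹ (1 - d_v)⁻¹`, `‖d_v‖ = q_v^{-(1+2t)}`
  set d : {v : HeightOneSpectrum (𝓞 F) // v ∉ S} → ℂ := fun v =>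
    μ₂.valueAtUniformizer v.1 * ν.valueAtUniformizer v.1 * ((v.1.residueCard : ℂ) ^ (-s)) with hd_def
  have hq0' : ∀ w : HeightOneSpectrum (𝓞 F), ((w.residueCard : ℂ)) ≠ 0 := fun w =>
    Nat.cast_ne_zero.2 (Nat.pos_iff_ne_zero.1 (Nat.zero_lt_of_lt w.one_lt_residueCard))
  have hone : ∀ w : HeightOneSpectrum (𝓞 F),
      μ₁.valueAtUniformizer w * ν.valueAtUniformizer w * ((w.residueCard : ℂ) ^ (-s)) =
        ((w.residueCard : ℂ))⁻¹ := fun w => by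
    have hprod : μ₁.valueAtUniformizer w * ν.valueAtUniformizer w = (w.residueCard : ℂ) ^ (t : ℂ) := by
      rw [hν_def, GaloisRepresentations.HeckeCharacter.valueAtUniformizer_inv,
        GaloisRepresentations.HeckeCharacter.valueAtUniformizer_mul,
        HeckeCharacter.valueAtUniformizer_of_cpow hNt w, mul_inv, inv_inv, ← mul_assoc,
        mul_inv_cancel₀ (heckeCharacter_valueAtUniformizer_ne_zero μ₁ w), one_mul]
    rw [hprod, ← Complex.cpow_add _ _ (hq0' w), hs_def]
    push_cast
    rw [show (t : ℂ) + -(1 + (t : ℂ)) = -1 by ring, Complex.cpow_neg_one]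
  have hnd : ∀ v : {v : HeightOneSpectrum (𝓞 F) // v ∉ S}, ‖d v‖ = (v.1.residueCard : ℝ) ^ (-(1 + 2 * t)) :=
    fun v => by
    rw [hd_def]
    simp only
    rw [norm_mul, norm_mul, hn₂, hnν, mul_one,
      Complex.norm_natCast_cpow_of_pos (Nat.zero_lt_of_lt v.1.one_lt_residueCard), Complex.neg_re,
      hs_def, Complex.ofReal_re, ← Real.rpow_add (hq0 v.1)]
    congr 1
    ring
  have hd : Summable fun v : {v : HeightOneSpectrum (𝓞 F) // v ∉ S} => ‖d v‖ := by
    simp_rw [hnd]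
    exact (summable_residueCard_rpow_neg (K := F) (by linarith)).comp_injective Subtype.val_injective
  have hd1 : ∀ v : {v : HeightOneSpectrum (𝓞 F) // v ∉ S}, 1 - d v ≠ 0 := fun v => by
    intro h
    have h' : ‖d v‖ = 1 := by rw [(sub_eq_zero.mp h).symm, norm_one]
    rw [hnd] at h'
    have h2 : (2 : ℝ) ≤ v.1.residueCard := by exact_mod_cast v.1.one_lt_residueCard
    have : (v.1.residueCard : ℝ) ^ (-(1 + 2 * t)) < 1 :=
      Real.rpow_lt_one_of_one_lt_of_neg (by linarith) (by linarith)
    linarith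
  refine not_multipliable_of_mul_one_sub_eq_zetaFactor hS hd (F := fun v =>
    ((satakePairPolynomial (α v.1) (β v.1)).eval ((v.1.residueCard : ℂ) ^ (-s)))⁻¹) ?_ hm
  intro v
  simp only [hα_def, hβ_def]
  rw [eval_satakePairPolynomial_pair_singleton, hone v.1, show μ₂.valueAtUniformizer v.1 *
      ν.valueAtUniformizer v.1 * ((v.1.residueCard : ℂ) ^ (-s)) = d v from rfl, mul_inv,
    mul_assoc, inv_mul_cancel₀ (hd1 v), mul_one]

/-- **Case `t = 0`: a simple pole against a finite limit at `s = 1`.**  Granting Jacquet–Shalika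
(2.1)–(2.3) for Borel–Jacquet data: no cuspidal datum `π` on `GL₂(𝔸_F)` has the Satake parameters
`{μ₁(ϖ_w), μ₂(ϖ_w)}` a.e. for two UNITARY Hecke characters `μ₁, μ₂` — (2.2) at `s₀ = 1` for
`(π, μ₁⁻¹)`, `(π, μ₂⁻¹)` (ranks `2 ≠ 1`) gives finite limits, (2.3) at `s₀ = 1` for `(π, π ⊗ (μ₁μ₂)⁻¹)`
(contragredient parameters `{μ₂(ϖ)⁻¹, μ₁(ϖ)⁻¹}`) gives a pole of `(s - 1) L^S(s, π × π')`, and factor by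
factor `L^S(s, π × π') = L^S(s, π × μ₂⁻¹) L^S(s, π × μ₁⁻¹)` on `Re s > 1` (multipliable by (2.1)).
Skinner's "`L(ψ₁/ψ₂, 1) ≠ 0` … `L(π ⊗ ψ₂⁻¹, s)` has a pole at `s = 1`, contradicting the cuspidality
of `π`". [cite: Skinner2009, §2.4.2 Remark (p. 257)] [cite: ArthurClozelAMS120, Ch. 3 §2 (2.2)–(2.3)] -/
theorem false_of_hasSatakeParamAt_heckePair_of_isUnitary
    (hJ1 : JacquetShalika1981_multipliable_partialPairL_repData)
    (hJ2 : JacquetShalika1981_partialPairL_boundary_repData)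
    (hJ3 : JacquetShalika1981_partialPairL_pole_repData)
    {h2 : isCompact_glFiniteIntegralLevel 2 F}
    (π : CuspidalAutomorphicRepData 2 F h2) (μ₁ μ₂ : HeckeCharacter F)
    (hμ₁ : μ₁.IsUnitary) (hμ₂ : μ₂.IsUnitary)
    (hπ : ∀ᶠ w : HeightOneSpectrum (𝓞 F) in cofinite,
      π.1.HasSatakeParamAt w {μ₁.valueAtUniformizer w, μ₂.valueAtUniformizer w}) :
    False := by
  have h1 := isCompact_glFiniteIntegralLevel_holds 1 F
  haveI : (𝓝[{s : ℂ | 1 < s.re}] (1 : ℂ)).NeBot :=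
    mem_closure_iff_nhdsWithin_neBot.mp one_mem_closure_one_lt_re
  have hne : ∀ (χ : HeckeCharacter F) (w : HeightOneSpectrum (𝓞 F)), χ.valueAtUniformizer w ≠ 0 :=
    fun χ w => heckeCharacter_valueAtUniformizer_ne_zero χ w
  -- the `GL₁` data of `μ₁⁻¹`, `μ₂⁻¹` and the twist `π' = π ⊗ (μ₁ μ₂)⁻¹` (contragredient parameters)
  obtain ⟨τ₁, hτ₁⟩ := exists_cuspidal_glOne_hasSatakeParamAt_valueAtUniformizer h1 μ₁⁻¹
  obtain ⟨τ₂, hτ₂⟩ := exists_cuspidal_glOne_hasSatakeParamAt_valueAtUniformizer h1 μ₂⁻¹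
  obtain ⟨π', hπ'⟩ := CuspidalAutomorphicRepData.exists_twist_hecke_hasSatakeParamAt (μ₁ * μ₂)⁻¹ π
  -- the Satake families
  set α : SatakeFamily F := fun w => {μ₁.valueAtUniformizer w, μ₂.valueAtUniformizer w} with hα_def
  set γ₁ : SatakeFamily F := fun w => {(μ₁.valueAtUniformizer w)⁻¹} with hγ₁_def
  set γ₂ : SatakeFamily F := fun w => {(μ₂.valueAtUniformizer w)⁻¹} with hγ₂_def
  set β : SatakeFamily F := fun w => {(μ₂.valueAtUniformizer w)⁻¹, (μ₁.valueAtUniformizer w)⁻¹}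
    with hβ_def
  -- almost everywhere, the four data have these parameters
  have hP : ∀ᶠ w : HeightOneSpectrum (𝓞 F) in cofinite, π.1.HasSatakeParamAt w (α w) ∧
      τ₁.1.HasSatakeParamAt w (γ₁ w) ∧ τ₂.1.HasSatakeParamAt w (γ₂ w) ∧
      π'.1.HasSatakeParamAt w (β w) := by
    filter_upwards [hπ, hτ₁, hτ₂, hπ'] with w h h₁ h₂ h'
    refine ⟨h, ?_, ?_, ?_⟩
    · simpa only [hγ₁_def, GaloisRepresentations.HeckeCharacter.valueAtUniformizer_inv] using h₁
    · simpa only [hγ₂_def, GaloisRepresentations.HeckeCharacter.valueAtUniformizer_inv] using h₂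
    · have h3 := h' _ h
      have e : (({μ₁.valueAtUniformizer w, μ₂.valueAtUniformizer w} : Multiset ℂ).map
          ((μ₁ * μ₂)⁻¹.valueAtUniformizer w * ·)) = β w := by
        have ha := hne μ₁ w
        have hb := hne μ₂ w
        rw [GaloisRepresentations.HeckeCharacter.valueAtUniformizer_inv,
          GaloisRepresentations.HeckeCharacter.valueAtUniformizer_mul]
        simp only [hβ_def, Multiset.insert_eq_cons, Multiset.map_cons, Multiset.map_singleton]
        rw [show (μ₁.valueAtUniformizer w * μ₂.valueAtUniformizer w)⁻¹ * μ₁.valueAtUniformizer w =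
            (μ₂.valueAtUniformizer w)⁻¹ by field_simp,
          show (μ₁.valueAtUniformizer w * μ₂.valueAtUniformizer w)⁻¹ * μ₂.valueAtUniformizer w =
            (μ₁.valueAtUniformizer w)⁻¹ by field_simp]
      rwa [e] at h3
  -- the exceptional set
  obtain ⟨S₁, hS₁, hJ1a⟩ := hJ1 2 1 F h2 h1 two_pos one_pos π τ₁
  obtain ⟨S₂, hS₂, hJ1b⟩ := hJ1 2 1 F h2 h1 two_pos one_pos π τ₂
  obtain ⟨S₃, hS₃, hJ2a⟩ := hJ2 2 1 F h2 h1 two_pos one_pos π τ₁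
  obtain ⟨S₄, hS₄, hJ2b⟩ := hJ2 2 1 F h2 h1 two_pos one_pos π τ₂
  obtain ⟨S₅, hS₅, hJ3a⟩ := hJ3 2 F h2 two_pos π π'
  set B : Set (HeightOneSpectrum (𝓞 F)) := {w | ¬ (π.1.HasSatakeParamAt w (α w) ∧
      τ₁.1.HasSatakeParamAt w (γ₁ w) ∧ τ₂.1.HasSatakeParamAt w (γ₂ w) ∧
      π'.1.HasSatakeParamAt w (β w))} with hB_def
  have hB : B.Finite := Filter.eventually_cofinite.mp hP
  set S : Set (HeightOneSpectrum (𝓞 F)) := S₁ ∪ S₂ ∪ S₃ ∪ S₄ ∪ S₅ ∪ B with hS_def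
  have hS : S.Finite := ((((hS₁.union hS₂).union hS₃).union hS₄).union hS₅).union hB
  have sub₁ : S₁ ⊆ S := fun x hx => by simp [hS_def, hx]
  have sub₂ : S₂ ⊆ S := fun x hx => by simp [hS_def, hx]
  have sub₃ : S₃ ⊆ S := fun x hx => by simp [hS_def, hx]
  have sub₄ : S₄ ⊆ S := fun x hx => by simp [hS_def, hx]
  have sub₅ : S₅ ⊆ S := fun x hx => by simp [hS_def, hx]
  have hBS : ∀ w ∉ S, π.1.HasSatakeParamAt w (α w) ∧ τ₁.1.HasSatakeParamAt w (γ₁ w) ∧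
      τ₂.1.HasSatakeParamAt w (γ₂ w) ∧ π'.1.HasSatakeParamAt w (β w) := fun w hw => by
    by_contra h
    exact hw (Or.inr h)
  have hαS : ∀ w ∉ S, π.1.HasSatakeParamAt w (α w) := fun w hw => (hBS w hw).1
  have hγ₁S : ∀ w ∉ S, τ₁.1.HasSatakeParamAt w (γ₁ w) := fun w hw => (hBS w hw).2.1
  have hγ₂S : ∀ w ∉ S, τ₂.1.HasSatakeParamAt w (γ₂ w) := fun w hw => (hBS w hw).2.2.1
  have hβS : ∀ w ∉ S, π'.1.HasSatakeParamAt w (β w) := fun w hw => (hBS w hw).2.2.2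
  -- unitarity of the four families
  have hn₁ : ∀ w, ‖μ₁.valueAtUniformizer w‖ = 1 := fun w =>
    GaloisRepresentations.HeckeCharacter.norm_valueAtUniformizer_of_isUnitary hμ₁ w
  have hn₂ : ∀ w, ‖μ₂.valueAtUniformizer w‖ = 1 := fun w =>
    GaloisRepresentations.HeckeCharacter.norm_valueAtUniformizer_of_isUnitary hμ₂ w
  have huα : ∀ w ∉ S, ‖(α w).prod‖ = 1 := fun w _ => by
    simp only [hα_def, Multiset.insert_eq_cons, Multiset.prod_cons, Multiset.prod_singleton,
      norm_mul, hn₁, hn₂, mul_one]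
  have huγ₁ : ∀ w ∉ S, ‖(γ₁ w).prod‖ = 1 := fun w _ => by
    simp only [hγ₁_def, Multiset.prod_singleton, norm_inv, hn₁, inv_one]
  have huγ₂ : ∀ w ∉ S, ‖(γ₂ w).prod‖ = 1 := fun w _ => by
    simp only [hγ₂_def, Multiset.prod_singleton, norm_inv, hn₂, inv_one]
  have huβ : ∀ w ∉ S, ‖(β w).prod‖ = 1 := fun w _ => by
    simp only [hβ_def, Multiset.insert_eq_cons, Multiset.prod_cons, Multiset.prod_singleton,
      norm_mul, norm_inv, hn₁, hn₂, inv_one, mul_one]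
  -- the `X`-condition of (2.3) at `s₀ = 1`: `t_{π'} = t_π⁻¹`
  have hX : ∀ᶠ w : HeightOneSpectrum (𝓞 F) in cofinite,
      (α w).map ((((w.residueCard : ℂ)) ^ ((1 : ℂ) - 1)) * ·) = (β w).map (·⁻¹) :=
    Filter.Eventually.of_forall fun w => by
      simp only [hα_def, hβ_def, sub_self, Complex.cpow_zero, one_mul,
        Multiset.insert_eq_cons, Multiset.map_cons, Multiset.map_singleton, inv_inv]
      exact Multiset.cons_swap _ _ _
  -- (2.1) for `(π, τ₁)`, `(π, τ₂)` on `Re s > 1`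
  have m₁ : ∀ s : ℂ, 1 < s.re → Multipliable fun v : {v : HeightOneSpectrum (𝓞 F) // v ∉ S} =>
      ((satakePairPolynomial (α v.1) (γ₁ v.1)).eval ((v.1.residueCard : ℂ) ^ (-s)))⁻¹ :=
    fun s hs => hJ1a hS sub₁ hαS hγ₁S huα huγ₁ hs
  have m₂ : ∀ s : ℂ, 1 < s.re → Multipliable fun v : {v : HeightOneSpectrum (𝓞 F) // v ∉ S} =>
      ((satakePairPolynomial (α v.1) (γ₂ v.1)).eval ((v.1.residueCard : ℂ) ^ (-s)))⁻¹ :=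
    fun s hs => hJ1b hS sub₂ hαS hγ₂S huα huγ₂ hs
  -- (2.2) for `(π, τ₁)`, `(π, τ₂)` at `s₀ = 1` (`2 ≠ 1`, so `X = ∅`): finite limits
  obtain ⟨c₁, -, hF₁⟩ := hJ2a hS sub₃ hαS hγ₁S huα huγ₁ Complex.one_re
    (fun h => absurd h.1 (by norm_num))
  obtain ⟨c₂, -, hF₂⟩ := hJ2b hS sub₄ hαS hγ₂S huα huγ₂ Complex.one_re
    (fun h => absurd h.1 (by norm_num))
  -- (2.3) for `(π, π')` at `s₀ = 1`: a genuine pole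
  obtain ⟨c₃, hc₃, hG⟩ := hJ3a hS sub₅ hαS hβS huα huβ Complex.one_re hX
  -- `L^S(s, π × π') = L^S(s, π × τ₂) L^S(s, π × τ₁)` on `Re s > 1`
  have hId : ∀ w, satakePairPolynomial (α w) (β w) =
      satakePairPolynomial (α w) (γ₂ w) * satakePairPolynomial (α w) (γ₁ w) := fun w => by
    rw [← hm_satakePairPolynomial_add_right]
    rfl
  have heq : ∀ s : ℂ, 1 < s.re →
      partialPairL S α β s = partialPairL S α γ₂ s * partialPairL S α γ₁ s := fun s hs => by
    unfold partialPairL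
    have hfun : (fun v : {v : HeightOneSpectrum (𝓞 F) // v ∉ S} =>
        ((satakePairPolynomial (α v.1) (β v.1)).eval ((v.1.residueCard : ℂ) ^ (-s)))⁻¹) =
        fun v : {v : HeightOneSpectrum (𝓞 F) // v ∉ S} =>
          ((satakePairPolynomial (α v.1) (γ₂ v.1)).eval ((v.1.residueCard : ℂ) ^ (-s)))⁻¹ *
            ((satakePairPolynomial (α v.1) (γ₁ v.1)).eval ((v.1.residueCard : ℂ) ^ (-s)))⁻¹ := by
      funext v
      rw [hId v.1, eval_mul, mul_inv]
    rw [hfun, (m₂ s hs).tprod_mul (m₁ s hs)]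
  -- `(s - 1) L^S(s, π × π') → 0 · (c₂ c₁) = 0`, contradicting `c₃ ≠ 0`
  have hlim : Tendsto (fun s => (s - 1) * partialPairL S α β s) (𝓝[{s : ℂ | 1 < s.re}] 1)
      (𝓝 (0 * (c₂ * c₁))) := by
    refine (tendsto_sub_one_nhdsWithin_one_lt_re.mul (hF₂.mul hF₁)).congr' ?_
    refine eventually_nhdsWithin_of_forall fun s hs => ?_
    show (s - 1) * (partialPairL S α γ₂ s * partialPairL S α γ₁ s) = (s - 1) * partialPairL S α β s
    rw [heq s hs]
  rw [zero_mul] at hlim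
  exact hc₃ (tendsto_nhds_unique hG hlim)

/-- **The core**: granting Jacquet–Shalika (2.1)–(2.3) for Borel–Jacquet data, no cuspidal datum
`π` on `GL₂(𝔸_F)` has, at almost every place, the Satake parameters `{μ₁(ϖ_w), μ₂(ϖ_w)}` of two
Hecke characters with `|μ₁| = ‖·‖^{-t}`, `|μ₂| = ‖·‖^{t}`, `t ≥ 0` (the two cases
`false_of_hasSatakeParamAt_heckePair_of_isUnitary`, `…_of_pos`). [cite: JacquetShalikaAJM1981II, Thm. 4.4] -/
theorem false_of_hasSatakeParamAt_heckePair
    (hJ1 : JacquetShalika1981_multipliable_partialPairL_repData)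
    (hJ2 : JacquetShalika1981_partialPairL_boundary_repData)
    (hJ3 : JacquetShalika1981_partialPairL_pole_repData)
    {h2 : isCompact_glFiniteIntegralLevel 2 F}
    (π : CuspidalAutomorphicRepData 2 F h2) (μ₁ μ₂ : HeckeCharacter F) {t : ℝ} (ht : 0 ≤ t)
    (hμ₁ : ∀ x : ideleGroup F, ‖((μ₁ x : ℂˣ) : ℂ)‖ = ideleNorm x ^ (-t))
    (hμ₂ : ∀ x : ideleGroup F, ‖((μ₂ x : ℂˣ) : ℂ)‖ = ideleNorm x ^ t)
    (hπ : ∀ᶠ w : HeightOneSpectrum (𝓞 F) in cofinite,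
      π.1.HasSatakeParamAt w {μ₁.valueAtUniformizer w, μ₂.valueAtUniformizer w}) :
    False := by
  rcases ht.eq_or_lt with h | h
  · subst h
    refine false_of_hasSatakeParamAt_heckePair_of_isUnitary hJ1 hJ2 hJ3 π μ₁ μ₂ (fun x => ?_)
      (fun x => ?_) hπ
    · rw [hμ₁ x, neg_zero, Real.rpow_zero]
    · rw [hμ₂ x, Real.rpow_zero]
  · exact false_of_hasSatakeParamAt_heckePair_of_pos hJ1 π μ₁ μ₂ h hμ₁ hμ₂ hπ

/-- **A cuspidal automorphic representation of `GL₂(𝔸_F)` is not nearly equivalent to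
`χ₁|·|^{1/2} ⊞ χ₂|·|^{1/2}`** (Jacquet–Shalika 1981 II, Thm. 4.4, the case `GL₂` against an isobaric
sum of two idele class characters; the analytic half of Ribet's irreducibility argument, Skinner
2009, Remark p. 257: "this implies that `L(π ⊗ ψ₂⁻¹, s)` has a pole at `s = 1`, contradicting the
cuspidality of `π`"). Granting Jacquet–Shalika (2.1)–(2.3) for Borel–Jacquet data
(`JacquetShalika1981_multipliable_partialPairL_repData`, `…_partialPairL_boundary_repData`,
`…_partialPairL_pole_repData`): for every number field `F`, every cuspidal datum `π` on `GL₂(𝔸_F)`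
and all Hecke characters `χ₁, χ₂` of `F` it is NOT the case that at almost every place every Satake
parameter `α` of `π` satisfies `{√q_v a : a ∈ α} = {χ₁(ϖ_v), χ₂(ϖ_v)}`. Proof: `|χ_i| = ‖·‖^{σ_i}`;
twist `π` by `‖·‖^{-1/2-(σ₁+σ₂)/2}` to a cuspidal `π₁` with parameters `{μ₁(ϖ_v), μ₂(ϖ_v)}`,
`|μ₁| = ‖·‖^{-t}`, `|μ₂| = ‖·‖^{t}`, `t = |σ₁ - σ₂|/2`; if `t > 0`, (2.1) for `(π₁, (μ₁‖·‖^t)⁻¹)` at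
`s = 1 + t` would make `∏_v (1 - q_v⁻¹)⁻¹ (1 - d_v)⁻¹`, `‖d_v‖ = q_v^{-1-2t}`, multipliable, against
`∑_v q_v⁻¹ = ∞`; if `t = 0`, (2.2) for `(π₁, μ₁⁻¹)`, `(π₁, μ₂⁻¹)` and (2.3) for `(π₁, π₁ ⊗ (μ₁μ₂)⁻¹)`
give a finite limit and a pole of the same `(s - 1) L^S(s, π₁ × π₁^∨)` at `s = 1`.
[cite: JacquetShalikaAJM1981II, Thm. 4.4] [cite: Skinner2009, §2.4.2 Remark (p. 257)]
[cite: ArthurClozelAMS120, Ch. 3 §2 (2.1)–(2.3)] -/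
theorem not_eventually_satake_eq_heckePair_of_JS
    (hJ1 : JacquetShalika1981_multipliable_partialPairL_repData)
    (hJ2 : JacquetShalika1981_partialPairL_boundary_repData)
    (hJ3 : JacquetShalika1981_partialPairL_pole_repData)
    {hcpt : isCompact_glFiniteIntegralLevel 2 F}
    (π : CuspidalAutomorphicRepData 2 F hcpt) (χ₁ χ₂ : HeckeCharacter F) :
    ¬ ∀ᶠ v : HeightOneSpectrum (𝓞 F) in cofinite,
        ∀ α : Multiset ℂ, π.1.HasSatakeParamAt v α →
          α.map (fun a => (((Real.sqrt (v.residueCard : ℝ)) : ℝ) : ℂ) * a) =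
            ({χ₁.valueAtUniformizer v, χ₂.valueAtUniformizer v} : Multiset ℂ) := by
  intro H
  obtain ⟨σ₁, hσ₁⟩ := χ₁.exists_norm_apply_eq_ideleNorm_rpow
  obtain ⟨σ₂, hσ₂⟩ := χ₂.exists_norm_apply_eq_ideleNorm_rpow
  wlog h12 : σ₁ ≤ σ₂ generalizing χ₁ χ₂ σ₁ σ₂
  · refine this χ₂ χ₁ ?_ σ₂ hσ₂ σ₁ hσ₁ (le_of_not_ge h12)
    filter_upwards [H] with v hv α hα
    rw [hv α hα, Multiset.pair_comm]
  have hNpos : ∀ x : ideleGroup F, 0 < ideleNorm x :=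
    GaloisRepresentations.HeckeCharacter.ideleNorm_pos' F
  -- the unitary normalisation `π₁ = π ⊗ ‖·‖^z`, `z = -1/2 - (σ₁+σ₂)/2`
  set t : ℝ := (σ₂ - σ₁) / 2 with ht_def
  have ht : 0 ≤ t := by rw [ht_def]; linarith
  set z : ℝ := -(1 / 2) - (σ₁ + σ₂) / 2 with hz_def
  obtain ⟨θ, hθ⟩ := exists_heckeCharacter_ideleNorm_cpow F (z : ℂ)
  obtain ⟨Nh, hNh⟩ := exists_heckeCharacter_ideleNorm_cpow F ((1 / 2 : ℝ) : ℂ)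
  obtain ⟨π₁, hπ₁⟩ := CuspidalAutomorphicRepData.exists_twist_hecke_hasSatakeParamAt θ π
  set μ₁ : HeckeCharacter F := χ₁ * Nh * θ with hμ₁_def
  set μ₂ : HeckeCharacter F := χ₂ * Nh * θ with hμ₂_def
  have hμ₁ : ∀ x : ideleGroup F, ‖((μ₁ x : ℂˣ) : ℂ)‖ = ideleNorm x ^ (-t) := fun x => by
    rw [hμ₁_def, GaloisRepresentations.HeckeCharacter.mul_apply,
      GaloisRepresentations.HeckeCharacter.mul_apply, Units.val_mul, Units.val_mul, norm_mul,
      norm_mul, hσ₁ x, GaloisRepresentations.HeckeCharacter.norm_apply_of_forall_apply_eq_cpow hNh x,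
      GaloisRepresentations.HeckeCharacter.norm_apply_of_forall_apply_eq_cpow hθ x,
      Complex.ofReal_re, Complex.ofReal_re, ← Real.rpow_add (hNpos x), ← Real.rpow_add (hNpos x)]
    congr 1
    rw [ht_def, hz_def]
    ring
  have hμ₂ : ∀ x : ideleGroup F, ‖((μ₂ x : ℂˣ) : ℂ)‖ = ideleNorm x ^ t := fun x => by
    rw [hμ₂_def, GaloisRepresentations.HeckeCharacter.mul_apply,
      GaloisRepresentations.HeckeCharacter.mul_apply, Units.val_mul, Units.val_mul, norm_mul,
      norm_mul, hσ₂ x, GaloisRepresentations.HeckeCharacter.norm_apply_of_forall_apply_eq_cpow hNh x,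
      GaloisRepresentations.HeckeCharacter.norm_apply_of_forall_apply_eq_cpow hθ x,
      Complex.ofReal_re, Complex.ofReal_re, ← Real.rpow_add (hNpos x), ← Real.rpow_add (hNpos x)]
    congr 1
    rw [ht_def, hz_def]
    ring
  -- the Satake parameters of `π₁` are `{μ₁(ϖ_w), μ₂(ϖ_w)}` almost everywhere
  have hπ₁' : ∀ᶠ w : HeightOneSpectrum (𝓞 F) in cofinite,
      π₁.1.HasSatakeParamAt w {μ₁.valueAtUniformizer w, μ₂.valueAtUniformizer w} := by
    filter_upwards [H, hπ₁, π.1.hasSatakeParamAt_cofinite_holds] with w hH h1 hex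
    obtain ⟨α, hα⟩ := hex
    set c : ℂ := (((Real.sqrt (w.residueCard : ℝ)) : ℝ) : ℂ) with hc_def
    have hq0 : (0 : ℝ) < w.residueCard := Nat.cast_pos.2 (Nat.zero_lt_of_lt w.one_lt_residueCard)
    have hc : c ≠ 0 := by
      rw [hc_def, Complex.ofReal_ne_zero]
      exact (Real.sqrt_pos.2 hq0).ne'
    have e := hH α hα
    have hα' : α = ({χ₁.valueAtUniformizer w, χ₂.valueAtUniformizer w} : Multiset ℂ).map (c⁻¹ * ·) := by
      rw [← e, Multiset.map_map]
      simp only [Function.comp_def, ← mul_assoc, inv_mul_cancel₀ hc, one_mul, Multiset.map_id']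
    have hNh_w : Nh.valueAtUniformizer w = c⁻¹ := by
      rw [HeckeCharacter.valueAtUniformizer_of_cpow hNh w, hc_def, Real.sqrt_eq_rpow,
        Complex.ofReal_cpow (Nat.cast_nonneg _), Complex.ofReal_natCast]
    have h2 := h1 α hα
    have e2 : α.map (θ.valueAtUniformizer w * ·) =
        ({μ₁.valueAtUniformizer w, μ₂.valueAtUniformizer w} : Multiset ℂ) := by
      rw [hα', Multiset.map_map]
      simp only [Function.comp_def, Multiset.insert_eq_cons, Multiset.map_cons,
        Multiset.map_singleton, hμ₁_def, hμ₂_def,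
        GaloisRepresentations.HeckeCharacter.valueAtUniformizer_mul, hNh_w]
      rw [show θ.valueAtUniformizer w * (c⁻¹ * χ₁.valueAtUniformizer w) =
          χ₁.valueAtUniformizer w * c⁻¹ * θ.valueAtUniformizer w by ring,
        show θ.valueAtUniformizer w * (c⁻¹ * χ₂.valueAtUniformizer w) =
          χ₂.valueAtUniformizer w * c⁻¹ * θ.valueAtUniformizer w by ring]
    rwa [e2] at h2
  exact false_of_hasSatakeParamAt_heckePair hJ1 hJ2 hJ3 π₁ μ₁ μ₂ ht hμ₁ hμ₂ hπ₁'

end Core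

/-! ### Assembly: the named fact from Böckle–Hui Thm. 1.1, eigenvalue rationality and Jacquet–Shalika -/

section Assembly

/-- **The analytic half `hJS` of `HilbertModularGaloisRepProofs`, from Jacquet–Shalika (2.1)–(2.3)
for Borel–Jacquet data** — in the exact shape of the hypothesis `hJS` of
`galoisRep_GL2_totallyReal_irreducible_of_abelianSummandIsHecke_of_not_eisenstein` (the total
reality of `K`, the regularity of `π`, the algebraicity and the unramifiedness of the `χ_i` are not
used: `not_eventually_satake_eq_heckePair_of_JS`). [cite: JacquetShalikaAJM1981II, Thm. 4.4]
[cite: Skinner2009, §2.4.2 Remark (p. 257)] -/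
theorem not_nearlyEisenstein_GL2_totallyReal_of_JS
    (hJ1 : JacquetShalika1981_multipliable_partialPairL_repData)
    (hJ2 : JacquetShalika1981_partialPairL_boundary_repData)
    (hJ3 : JacquetShalika1981_partialPairL_pole_repData) :
    ∀ {K : Type} [Field K] [NumberField K] (hcpt : isCompact_glFiniteIntegralLevel 2 K),
      IsTotallyReal K → ∀ (π : CuspidalAutomorphicRepData 2 K hcpt), π.1.IsRegularAlgebraic →
      ∀ (χ₁ χ₂ : HeckeCharacter K), χ₁.IsAlgebraic → χ₂.IsAlgebraic →
      ¬ ∀ᶠ v : HeightOneSpectrum (𝓞 K) in cofinite,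
          χ₁.IsUnramifiedAt v ∧ χ₂.IsUnramifiedAt v ∧
          ∀ α : Multiset ℂ, π.1.HasSatakeParamAt v α →
            α.map (fun a => (((Real.sqrt (v.residueCard : ℝ)) : ℝ) : ℂ) * a) =
              ({χ₁.valueAtUniformizer v, χ₂.valueAtUniformizer v} : Multiset ℂ) :=
  fun _ _ π _ χ₁ χ₂ _ _ h =>
    not_eventually_satake_eq_heckePair_of_JS hJ1 hJ2 hJ3 π χ₁ χ₂ (h.mono fun _ hv => hv.2.2)

/-- **The fact from the dictionary input and Jacquet–Shalika**:
`galoisRep_GL2_totallyReal_irreducible_of_abelianSummandIsHecke_of_not_eisenstein` with its analytic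
half discharged from (2.1)–(2.3) for Borel–Jacquet data; the remaining hypothesis `hdict` is the
`n = 2`, totally real case of "abelian summands of `ρ_π` are Hecke" (Hodge–Tate + Serre III §2.3–2.4
in print; Böckle–Hui Thm. 1.1 + `E`-rationality in the tree). [cite: Skinner2009, §2.4.2 Remark (p. 257)]
[cite: ArthurClozelAMS120, Ch. 3 §2 (2.1)–(2.3)] -/
theorem galoisRep_GL2_totallyReal_irreducible_of_abelianSummandIsHecke_of_JS
    (hdict : ∀ {K : Type} [Field K] [NumberField K] (hcpt : isCompact_glFiniteIntegralLevel 2 K),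
      IsTotallyReal K → ∀ (π : CuspidalAutomorphicRepData 2 K hcpt), π.1.IsRegularAlgebraic →
      ∀ (ℓ : ℕ) [Fact ℓ.Prime] (ι : PadicAlgCl ℓ ≃+* ℂ)
        (r : GaloisRepresentations.FramedGaloisRep K (PadicAlgCl ℓ) 2),
      r.toGaloisRep.IsSemisimple →
      (∀ (v : HeightOneSpectrum (𝓞 K)) (α : Multiset ℂ), π.1.HasSatakeParamAt v α →
          ((ℓ : ℕ) : 𝓞 K) ∉ v.asIdeal →
            r.IsUnramifiedAt v ∧ r.HasFrobCharpolyAt v (arithFrobPolyOfSatake ι v.residueCard 2 α)) →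
      ∀ (τ : GaloisRepresentations.FramedGaloisRep K (PadicAlgCl ℓ) 1),
      (∃ x : Fin 2 → PadicAlgCl ℓ, x ≠ 0 ∧ ∀ g : Field.absoluteGaloisGroup K,
          r.toGaloisRep g x =
            ((Matrix.GeneralLinearGroup.det (τ g) : (PadicAlgCl ℓ)ˣ) : PadicAlgCl ℓ) • x) →
      ∃ χ : HeckeCharacter K, χ.IsAlgebraic ∧
        ∀ᶠ v : HeightOneSpectrum (𝓞 K) in cofinite, χ.IsUnramifiedAt v ∧ τ.IsUnramifiedAt v ∧
          τ.HasFrobCharpolyAt v (X - C (ι.symm (χ.valueAtUniformizer v)⁻¹)))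
    (hJ1 : JacquetShalika1981_multipliable_partialPairL_repData)
    (hJ2 : JacquetShalika1981_partialPairL_boundary_repData)
    (hJ3 : JacquetShalika1981_partialPairL_pole_repData) :
    galoisRep_GL2_totallyReal_irreducible :=
  galoisRep_GL2_totallyReal_irreducible_of_abelianSummandIsHecke_of_not_eisenstein hdict
    (not_nearlyEisenstein_GL2_totallyReal_of_JS hJ1 hJ2 hJ3)

/-- **The fact from Böckle–Hui Thm. 1.1, the `E`-rationality of compatible `r`, and
Jacquet–Shalika**: `galoisRep_GL2_totallyReal_irreducible_of_weaklyDivides_of_rational_of_not_eisenstein`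
with `hJS` discharged. [cite: BockleHui2025, Theorem 1.1 and §3.2.1]
[cite: ArthurClozelAMS120, Ch. 3 §2 (2.1)–(2.3)] -/
theorem galoisRep_GL2_totallyReal_irreducible_of_weaklyDivides_of_rational_of_JS
    (hBH : GaloisRepresentations.exists_heckeCharacter_of_weaklyDivides)
    (hrat : ∀ {K : Type} [Field K] [NumberField K] (hcpt : isCompact_glFiniteIntegralLevel 2 K),
      IsTotallyReal K → ∀ (π : CuspidalAutomorphicRepData 2 K hcpt), π.1.IsRegularAlgebraic →
      ∀ (ℓ : ℕ) [Fact ℓ.Prime] (ι : PadicAlgCl ℓ ≃+* ℂ)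
        (r : GaloisRepresentations.FramedGaloisRep K (PadicAlgCl ℓ) 2),
      r.toGaloisRep.IsSemisimple →
      (∀ (v : HeightOneSpectrum (𝓞 K)) (α : Multiset ℂ), π.1.HasSatakeParamAt v α →
          ((ℓ : ℕ) : 𝓞 K) ∉ v.asIdeal →
            r.IsUnramifiedAt v ∧ r.HasFrobCharpolyAt v (arithFrobPolyOfSatake ι v.residueCard 2 α)) →
      ∃ (E : Type) (_ : Field E) (_ : NumberField E) (e : E →+* PadicAlgCl ℓ), r.IsRationalOver e)
    (hJ1 : JacquetShalika1981_multipliable_partialPairL_repData)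
    (hJ2 : JacquetShalika1981_partialPairL_boundary_repData)
    (hJ3 : JacquetShalika1981_partialPairL_pole_repData) :
    galoisRep_GL2_totallyReal_irreducible :=
  galoisRep_GL2_totallyReal_irreducible_of_weaklyDivides_of_rational_of_not_eisenstein hBH hrat
    (not_nearlyEisenstein_GL2_totallyReal_of_JS hJ1 hJ2 hJ3)

/-- **The fact from Böckle–Hui Thm. 1.1, the rationality of the Hecke eigenvalues of `π`, and
Jacquet–Shalika (2.1)–(2.3) for Borel–Jacquet data** — the assembly
`galoisRep_GL2_totallyReal_irreducible_of_weaklyDivides_of_heckeEigenvalue_mem_of_not_eisenstein`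
with its analytic half discharged.  Of the five hypotheses four are named facts of the tree; the
remaining one, `hShi`, is the printed statement "the unramified Hecke eigenvalues
`t_{v,1}, t_{v,2}` of a regular algebraic cuspidal `π` on `GL₂` over a totally real field lie in a
number field `E ⊆ ℂ`" (Shimura 1978; Clozel 1990, Thm. 3.13; Böckle–Hui §3.1), which has no carrier
in the tree.  When these are discharged, `galoisRep_GL2_totallyReal_irreducible_holds` is this
theorem applied to their proofs. [cite: Skinner2009, §2.4.2 Remark (p. 257)]
[cite: BockleHui2025, Theorem 1.1, §3.1 and §3.2.1] [cite: ArthurClozelAMS120, Ch. 3 §2 (2.1)–(2.3)] -/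
theorem galoisRep_GL2_totallyReal_irreducible_of_weaklyDivides_of_heckeEigenvalue_mem_of_JS
    (hBH : GaloisRepresentations.exists_heckeCharacter_of_weaklyDivides)
    (hShi : ∀ {K : Type} [Field K] [NumberField K] (hcpt : isCompact_glFiniteIntegralLevel 2 K),
      IsTotallyReal K → ∀ (π : CuspidalAutomorphicRepData 2 K hcpt), π.1.IsRegularAlgebraic →
      ∃ E : Subfield ℂ, FiniteDimensional ℚ E ∧
        ∀ᶠ v : HeightOneSpectrum (𝓞 K) in cofinite, ∀ α : Multiset ℂ,
          π.1.HasSatakeParamAt v α → ∀ i ≤ 2, heckeEigenvalueOf 2 v α i ∈ E)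
    (hJ1 : JacquetShalika1981_multipliable_partialPairL_repData)
    (hJ2 : JacquetShalika1981_partialPairL_boundary_repData)
    (hJ3 : JacquetShalika1981_partialPairL_pole_repData) :
    galoisRep_GL2_totallyReal_irreducible :=
  galoisRep_GL2_totallyReal_irreducible_of_weaklyDivides_of_heckeEigenvalue_mem_of_not_eisenstein hBH
    hShi (not_nearlyEisenstein_GL2_totallyReal_of_JS hJ1 hJ2 hJ3)

end Assembly

end Literature.NumberTheory.Automorphic

end
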